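import Mathlib
import HarnessLib
import Literature.MathematicalPhysics.QuantumLattice.GrassmannEffectiveActionCopies
import Summits.HubbardSuperconductivity.HubbardSuperconductivity.Theorems.KLProgrammeKLRegimeTwoVolumeSourceReadout
import Summits.HubbardSuperconductivity.HubbardSuperconductivity.Theorems.KLProgrammeKLRegimeTwoVolumeTorusBlocks
import Summits.HubbardSuperconductivity.HubbardSuperconductivity.Theorems.KLProgrammeKLRegimeTwoVolumeGridCounterGluingArith
import Summits.HubbardSuperconductivity.HubbardSuperconductivity.Theorems.KLProgrammeKLRegimeVolumeLimitTorusPeriodisationSplit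

/-!
# Route `KLProgramme` — crux K3, VL child `KLRegimeVolumeLimitV17F2` (stmt-HubbardSuperconductivity-20440): THE SOURCE PAIR AT A DEEP FINE PIN IN THE
# (vi) CHAIN'S GLUED CURRENCY — decorated-leg block structure, the e-free reading of glued kernels, and `2ε·NEAR ≤ 2ε·GLUED + far rows`
# (cell gate-hubbard-kl, seat hubbard-kl-k3c5-p3 g12, technique «OS-positivity-free direct assembly»)

k3c4-p1's own-top-frame two-volume induction (blueprint v4, evidence #36 on 20440; scale-`0` base `…TwoVolumeScaleZeroTopFrame`, M4a) runs in ONE currency: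
for nested tori `L″ = b·L`, at an `R`-deep FINE pin `w` (every coordinate residue of the pin's site in `[R, L − R)`), the GLUED pinned defect
`Σ_{X : X p = w} ‖kernel A_{L″} X − (if every leg of X lies in the pin's block then kernel A_L (residue string of X) else 0)‖` — the e-free reading of
`A_{L″} − Σ_β A_L ∘ f_β` (`GrassmannEffectiveActionCopies.kernel_copies_sum`).  The END doors of this lineage (`…TwoVolumeSourceReadout` (h),
`…VolumeLimitV9NearDefectDoor`) read the NEAR same-offset defect between a coarse pin `o_c` and a fine pin `o_f` (offsets `ȳ ∈ 𝕋_L` against their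
centred lifts `ȳ↑ ∈ 𝕋_{L″}`).  This file is the comparison of the two currencies for the chain's last object `srcTrunc 3 (klSrcAction_V[K_V] n)` on
`SrcLabel V M n` (V = L, L″); the doors are in `…VolumeLimitV9GluedDefectDoor`.

* §1 (generic, DECORATED legs `((T × 𝕋_V) × S) × C` — covers `GridLeg (GridPoint V N)` and `SrcLabel V M n`): `exists_decoratedLegBlockEquiv` (the block
  structure `e` with block `⌊x/L⌋` and residue projection — `…TwoVolumeTorusBlocks.exists_gridLegBlockEquiv` for general decorations) and
  **`kernel_glued_eq_ite`** (the e-free reading `kernel (Σ_β map f_β W) X = if [all legs in the block of leg p] then kernel W (residue string) else 0`;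
  M4a's private `hsub` made public and generic);
* §2 geometry of the source pair at a deep pin: `block_eq_of_deep_of_natAbs_lt` (an offset `ȳ↑` with `|ȳ_i| < R` from an `R`-deep site stays in its block,
  ∘ `sub_eq_intCast_iff_of_deep`), `reduce_add_clift` (its residue is `red o⃗_f + ȳ` — for EVERY `ȳ`), `tnorm_le_tnorm_clift`, `le_tnorm_of_not_near`;
* §3 `sum_filter_le_inv_mul_weighted` and **`twoEps_near_le_glued_add_far`**: `2ε·NEAR(o_c := (t, red o⃗_f), o_f) ≤ 2ε·GLUED(o_f) + 2(B_c + B_f)/(1 + Λ_n·R)`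
  for the source-pair kernels of `srcTrunc 3 (klSrcAction …)` at any two frames, where `B_c`, `B_f` bound the two volumes' `klSrcPinnedSum … n 2 2 0 (pin)`
  (token #24 at `s = m = 2`): near offsets (`|ȳ|_∞ < R`) ARE glued strings at the pin with the coarse pair as residue string, far offsets are paid by the
  weight `1 + Λ_n‖·‖_𝕋` in BOTH volumes (`tnorm ȳ↑ ≥ tnorm ȳ`, k3c5-p2's `clift_injective`, `weightedRows_le_klSrcPinnedSum`).
Proofs only; no definition; nothing asserts superconductivity.  References: BGM 2006 §2.4 (2.38), §2.9 (4.3)–(4.6); Salmhofer 1999 §4.2.4 (4.58), (2.102)–(2.106).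
-/

noncomputable section

/-! ## §1 Decorated legs over a nested torus: block structure and the e-free reading of glued kernels -/

namespace Summit.HubbardSuperconductivity.HubbardSuperconductivity.Theorems.TwoVolumeDefect

set_option linter.dupNamespace false -- summit = problem name (single-conjunct summit), D-0017

open Finset Literature.MathematicalPhysics.QuantumLattice GrassmannAlgebra Literature.Probability.LatticeModels
open Summit.HubbardSuperconductivity.HubbardSuperconductivity.Theorems.TwoPointAssembly (reduce_add reduce_clift tnorm_reduce_le)

section Decorated

variable {b L Lf : ℕ} [NeZero Lf] [NeZero L] {T S C : Type*}

/-- **THE BLOCK STRUCTURE OF DECORATED LEGS** `((T × 𝕋²_{L″}) × S) × C` over the nested torus `L″ = b·L` (decorations untouched): a bijection onto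
`(Fin 2 → Fin b) × (((T × 𝕋²_L) × S) × C)` with block `(⌊x_i/L⌋)_i` of the site and projection `(((t, x), s), c) ↦ (((t, red x), s), c)`; `GridLeg (GridPoint · N)`
(`T = Fin N`, `S = C = Fin 2`) and `SrcLabel · M n` (`T = ImagTimeIdx M`, `S = SectorLeg N_n`, `C = Fin 2`) are instances. [folklore] -/
theorem exists_decoratedLegBlockEquiv (hLf : Lf = b * L) :
    ∃ e : ((T × TorusSite 2 Lf) × S) × C ≃ (Fin 2 → Fin b) × (((T × TorusSite 2 L) × S) × C),
      (∀ X' i, ((e X').1 i : ℕ) = (X'.1.1.2 i).val / L) ∧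
        (∀ X', (e X').2 = (((X'.1.1.1, fun i => (((X'.1.1.2 i).val : ℕ) : ZMod L)), X'.1.2), X'.2)) := by
  obtain ⟨eS, hS1, hS2⟩ := exists_siteBlockEquiv (d := 2) hLf
  refine ⟨{ toFun := fun X' => ((eS X'.1.1.2).1, (((X'.1.1.1, (eS X'.1.1.2).2), X'.1.2), X'.2))
            invFun := fun p => (((p.2.1.1.1, eS.symm (p.1, p.2.1.1.2)), p.2.1.2), p.2.2)
            left_inv := ?_
            right_inv := ?_ }, fun X' i => hS1 _ i, fun X' => by
              show (((X'.1.1.1, (eS X'.1.1.2).2), X'.1.2), X'.2) = _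
              rw [hS2]⟩
  · rintro ⟨⟨⟨j, x⟩, σ⟩, c⟩
    simp
  · rintro ⟨q, ⟨⟨⟨j, y⟩, σ⟩, c⟩⟩
    simp

omit [NeZero Lf] in
/-- **THE e-FREE READING OF GLUED KERNELS on decorated legs** (M4a's `hsub`, public): for a block structure `e` with block `⌊x/L⌋` and residue projection
and block embeddings `f_β` (`(f_β v)(X') = [blk X' = β]·v(π X')`), the kernel of the glued element `Σ_β W ∘ f_β` at a string `X` is the kernel of `W` at the
RESIDUE string if every leg of `X` lies in the block of leg `p`, and `0` otherwise. [cite: Salmhofer1999, §4.2.4 (4.58)] -/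
theorem kernel_glued_eq_ite (e : ((T × TorusSite 2 Lf) × S) × C ≃ (Fin 2 → Fin b) × (((T × TorusSite 2 L) × S) × C))
    (he1 : ∀ X' i, ((e X').1 i : ℕ) = (X'.1.1.2 i).val / L)
    (he2 : ∀ X', (e X').2 = (((X'.1.1.1, fun i => (((X'.1.1.2 i).val : ℕ) : ZMod L)), X'.1.2), X'.2))
    [Fintype T] [DecidableEq T] [Fintype S] [DecidableEq S] [Fintype C] [DecidableEq C]
    (F : (Fin 2 → Fin b) → ((((T × TorusSite 2 L) × S) × C) → ℂ) →ₗ[ℂ] ((((T × TorusSite 2 Lf) × S) × C) → ℂ))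
    (hF : ∀ β v X', F β v X' = if (e X').1 = β then v (e X').2 else 0)
    (W : GrassmannAlgebra ℂ (((T × TorusSite 2 L) × S) × C)) {m : ℕ} (p : Fin m) (X : Fin m → ((T × TorusSite 2 Lf) × S) × C) :
    kernel ℂ (∑ β, ExteriorAlgebra.map (F β) W) m X =
      if ∀ i j, ((X i).1.1.2 j).val / L = ((X p).1.1.2 j).val / L then
        kernel ℂ W m (fun i => ((((X i).1.1.1, fun j => ((((X i).1.1.2 j).val : ℕ) : ZMod L)), (X i).1.2), (X i).2))
      else 0 := by
  classical
  rw [kernel_copies_sum e F hF W p X]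
  have hiff : (∀ i, (e (X i)).1 = (e (X p)).1) ↔ ∀ i j, ((X i).1.1.2 j).val / L = ((X p).1.1.2 j).val / L := by
    refine ⟨fun h i j => ?_, fun h i => funext fun j => Fin.ext ?_⟩
    · rw [← he1, ← he1, h i]
    · rw [he1, he1]; exact h i j
  have hproj : (fun i => (e (X i)).2) = fun i => ((((X i).1.1.1, fun j => ((((X i).1.1.2 j).val : ℕ) : ZMod L)), (X i).1.2), (X i).2) :=
    funext fun i => he2 (X i)
  by_cases h : ∀ i j, ((X i).1.1.2 j).val / L = ((X p).1.1.2 j).val / L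
  · rw [if_pos (hiff.2 h), if_pos h, hproj]
  · rw [if_neg (fun h' => h (hiff.1 h')), if_neg h]

end Decorated

/-! ## §2 Geometry of the source pair at a deep fine pin -/

section Geometry

variable {b L Lf : ℕ} [NeZero Lf] [NeZero L]

omit [NeZero Lf] [NeZero L] in
/-- The centred lift, coordinatewise: `(ȳ↑) i = (cRepZ ȳ_i : ℤ/L″)`. [folklore] -/
theorem clift_apply (ybar : TorusSite 2 L) (i : Fin 2) :
    (Torus.proj Lf (Torus.cRep ybar)) i = ((Torus.cRepZ (ybar i) : ℤ) : ZMod Lf) := by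
  rw [Torus.proj_apply, Torus.cRep]

/-- **A near offset from a deep site stays in the block**: for `L″ = b·L`, an `R`-deep fine site `x′` and `ȳ ∈ 𝕋_L` with `|cRepZ ȳ_i| < R` for all `i`,
`x′ + ȳ↑` lies in the block of `x′`. [folklore] -/
theorem block_eq_of_deep_of_natAbs_lt (hLf : Lf = b * L) {R : ℕ} (x' : TorusSite 2 Lf)
    (hx : ∀ i, R ≤ (x' i).val % L ∧ (x' i).val % L + R < L) (ybar : TorusSite 2 L) (hy : ∀ i, (Torus.cRepZ (ybar i)).natAbs < R) :
    ∀ i, ((x' + Torus.proj Lf (Torus.cRep ybar)) i).val / L = (x' i).val / L := by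
  have hs : ∀ i, (-(Torus.cRepZ (ybar i))).natAbs < R := fun i => by rw [Int.natAbs_neg]; exact hy i
  have hsub : x' - (x' + Torus.proj Lf (Torus.cRep ybar)) = fun i => (((-(Torus.cRepZ (ybar i)) : ℤ)) : ZMod Lf) := by
    funext i
    rw [Pi.sub_apply, Pi.add_apply, clift_apply, Int.cast_neg]
    ring
  exact ((sub_eq_intCast_iff_of_deep hLf x' (x' + Torus.proj Lf (Torus.cRep ybar)) hx (fun i => -(Torus.cRepZ (ybar i))) hs).1 hsub).1

/-- **The residue of `x′ + ȳ↑` is `red x′ + ȳ`** (every `ȳ`). [folklore] -/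
theorem reduce_add_clift (hLf : Lf = b * L) (x' : TorusSite 2 Lf) (ybar : TorusSite 2 L) :
    (fun i => ((((x' + Torus.proj Lf (Torus.cRep ybar)) i).val : ℕ) : ZMod L)) = (fun i => (((x' i).val : ℕ) : ZMod L)) + ybar := by
  rw [reduce_add hLf, reduce_clift hLf]

/-- **The centred lift does not decrease the torus distance**: `tnorm ȳ ≤ tnorm ȳ↑` (`L ∣ L″`; in fact equality). [folklore] -/
theorem tnorm_le_tnorm_clift (hLf : Lf = b * L) (ybar : TorusSite 2 L) : Torus.tnorm ybar ≤ Torus.tnorm (Torus.proj Lf (Torus.cRep ybar)) := by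
  have h := tnorm_reduce_le (d := 2) hLf (Torus.proj Lf (Torus.cRep ybar))
  rwa [reduce_clift hLf] at h

omit [NeZero L] in
/-- A non-near offset is far: if some `|cRepZ ȳ_i| ≥ R` then `R ≤ tnorm ȳ`. [folklore] -/
theorem le_tnorm_of_not_near {R : ℕ} {ybar : TorusSite 2 L} (h : ¬ ∀ i, (Torus.cRepZ (ybar i)).natAbs < R) : R ≤ Torus.tnorm ybar := by
  push Not at h
  obtain ⟨i, hi⟩ := h
  exact hi.trans (natAbs_cRepZ_apply_le_tnorm ybar i)

end Geometry

end Summit.HubbardSuperconductivity.HubbardSuperconductivity.Theorems.TwoVolumeDefect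

/-! ## §3 NEAR ≤ GLUED + far rows, for the source-pair kernels of `srcTrunc 3 (klSrcAction …)` -/

namespace Summit.HubbardSuperconductivity.HubbardSuperconductivity.Theorems.TwoVolumeSource

set_option linter.dupNamespace false -- summit = problem name (single-conjunct summit), D-0017

open Finset Literature.MathematicalPhysics.QuantumLattice Literature.Probability.LatticeModels GrassmannAlgebra
open Summit.HubbardSuperconductivity.HubbardSuperconductivity.Theorems.KLProgrammeLegKernels
open Summit.HubbardSuperconductivity.HubbardSuperconductivity.Theorems.KLRegimeSplit
open Summit.HubbardSuperconductivity.HubbardSuperconductivity.Theorems.TwoVolumeDefect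
open Summit.HubbardSuperconductivity.HubbardSuperconductivity.Theorems.EngineV8

section NearGlued

variable {b L Lf M : ℕ} [NeZero Lf] [NeZero L]

/-- A far sub-sum is at most `(1 + ΛR)⁻¹ ×` the weighted full sum, for weights `1 + Λ·w(y) ≥ 1 + ΛR` on the far set (`Λ ≥ 0`, nonnegative terms). [folklore] -/
theorem sum_filter_le_inv_mul_weighted {α : Type*} (s : Finset α) (P : α → Prop) [DecidablePred P] (g : α → ℝ) (w : α → ℕ)
    (hg : ∀ a ∈ s, 0 ≤ g a) {Λ : ℝ} (hΛ : 0 ≤ Λ) {R : ℕ} (hfar : ∀ a ∈ s, ¬ P a → R ≤ w a) :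
    ∑ a ∈ s.filter (fun a => ¬ P a), g a ≤ (1 + Λ * R)⁻¹ * ∑ a ∈ s, (1 + Λ * (w a : ℝ)) * g a := by
  have hR : (0 : ℝ) < 1 + Λ * R := by positivity
  rw [mul_sum]
  calc ∑ a ∈ s.filter (fun a => ¬ P a), g a ≤ ∑ a ∈ s.filter (fun a => ¬ P a), (1 + Λ * R)⁻¹ * ((1 + Λ * (w a : ℝ)) * g a) := by
        refine sum_le_sum fun a ha => ?_
        simp only [mem_filter] at ha
        have hw : (R : ℝ) ≤ w a := by exact_mod_cast hfar a ha.1 ha.2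
        have h1 : 1 ≤ (1 + Λ * R)⁻¹ * (1 + Λ * (w a : ℝ)) := by
          rw [inv_mul_eq_div, le_div_iff₀ hR, one_mul]; nlinarith
        calc g a = 1 * g a := (one_mul _).symm
          _ ≤ (1 + Λ * R)⁻¹ * (1 + Λ * (w a : ℝ)) * g a := mul_le_mul_of_nonneg_right h1 (hg a ha.1)
          _ = _ := by ring
    _ ≤ ∑ a ∈ s, (1 + Λ * R)⁻¹ * ((1 + Λ * (w a : ℝ)) * g a) :=
        sum_le_sum_of_subset_of_nonneg (filter_subset _ _) fun a ha _ => by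
          have := hg a ha; positivity

/-- **`2ε·NEAR ≤ 2ε·GLUED + 2(B_c + B_f)/(1 + Λ_n R)`** (see the module docstring): the NEAR same-offset pinned defect of the source-pair kernels of
`A_V := srcTrunc 3 (klSrcAction V M β U μ K_V n)` (`V = L, L″ = b·L`, any two frames) between the coarse pin `o_c := (t, red o⃗_f)` and an `R`-deep fine pin `o_f`
is at most the chain's GLUED pinned defect at `o_f` (e-free form, pin = the `(+)` source leg) plus the far rows of both volumes, which token #24's degree-2
two-source pinned sums `B_c`, `B_f` pay through the weight `1 + Λ_n‖·‖_𝕋 ≤ klScaleWt_n`. [cite: BenfattoGiulianiMastropietro2006, §2.4 (2.38)] -/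
theorem twoEps_near_le_glued_add_far (hLf : Lf = b * L) {β : ℝ} (hβ : 0 ≤ β) (U μ : ℝ) (Kc Kf : TrigPolyC4v) (n : ℕ)
    (of : SpaceTimeIdx Lf M) {R : ℕ} (hof : ∀ j, R ≤ (of.2 j).val % L ∧ (of.2 j).val % L + R < L) {Bc Bf : ℝ}
    (hBc : klSrcPinnedSum L M β U μ Kc n 2 2 0
      (((of.1, fun i => (((of.2 i).val : ℕ) : ZMod L)), ((⟨0, sectorCount_pos n⟩, 0), 0)), 1) ≤ Bc)
    (hBf : klSrcPinnedSum Lf M β U μ Kf n 2 2 0 ((of, ((⟨0, sectorCount_pos n⟩, 0), 0)), 1) ≤ Bf) :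
    2 * imagTimeWeight β M *
        (∑ t₁ : ImagTimeIdx M, ∑ ybar : TorusSite 2 L,
          ‖kernel ℂ (srcTrunc ℂ (fun Y : SrcLabel L M n => Y.2 = 1) 3 (klSrcAction L M β U μ Kc n)) 2
                ![(((of.1, fun i => (((of.2 i).val : ℕ) : ZMod L)), ((⟨0, sectorCount_pos n⟩, 0), 0)), 1),
                  (((t₁, (fun i => (((of.2 i).val : ℕ) : ZMod L)) + ybar), ((⟨0, sectorCount_pos n⟩, 0), 1)), 1)] -
              kernel ℂ (srcTrunc ℂ (fun Y : SrcLabel Lf M n => Y.2 = 1) 3 (klSrcAction Lf M β U μ Kf n)) 2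
                ![((of, ((⟨0, sectorCount_pos n⟩, 0), 0)), 1),
                  (((t₁, of.2 + Torus.proj Lf (Torus.cRep ybar)), ((⟨0, sectorCount_pos n⟩, 0), 1)), 1)]‖) ≤
      2 * imagTimeWeight β M *
          (∑ X ∈ univ.filter (fun X : Fin 2 → SrcLabel Lf M n => X 0 = ((of, ((⟨0, sectorCount_pos n⟩, 0), 0)), 1)),
            ‖kernel ℂ (srcTrunc ℂ (fun Y : SrcLabel Lf M n => Y.2 = 1) 3 (klSrcAction Lf M β U μ Kf n)) 2 X -
                (if ∀ i j, ((X i).1.1.2 j).val / L = ((X 0).1.1.2 j).val / L then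
                  kernel ℂ (srcTrunc ℂ (fun Y : SrcLabel L M n => Y.2 = 1) 3 (klSrcAction L M β U μ Kc n)) 2
                    (fun i => ((((X i).1.1.1, fun j => ((((X i).1.1.2 j).val : ℕ) : ZMod L)), (X i).1.2), (X i).2))
                else 0)‖) +
        2 * (Bc + Bf) / (1 + klScale klE0 n * R) := by
  -- names
  set sP : SectorLeg (sectorCount n) := ((⟨0, sectorCount_pos n⟩, 0), 0) with hsP
  set sM : SectorLeg (sectorCount n) := ((⟨0, sectorCount_pos n⟩, 0), 1) with hsM
  set Ac := srcTrunc ℂ (fun Y : SrcLabel L M n => Y.2 = 1) 3 (klSrcAction L M β U μ Kc n) with hAc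
  set Af := srcTrunc ℂ (fun Y : SrcLabel Lf M n => Y.2 = 1) 3 (klSrcAction Lf M β U μ Kf n) with hAf
  set ocs : TorusSite 2 L := fun i => (((of.2 i).val : ℕ) : ZMod L) with hocs
  set ε := imagTimeWeight β M with hε_def
  set Λ := klScale klE0 n with hΛ_def
  have hε : 0 ≤ ε := imagTimeWeight_nonneg hβ M
  have hΛ : 0 ≤ Λ := (klth_klScale_pos n).le
  -- the two source pairs and the glued summand
  let a : ImagTimeIdx M → TorusSite 2 L → ℂ := fun t₁ ybar =>
    kernel ℂ Ac 2 ![(((of.1, ocs), sP), 1), (((t₁, ocs + ybar), sM), 1)]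
  let f : ImagTimeIdx M → TorusSite 2 L → ℂ := fun t₁ ybar =>
    kernel ℂ Af 2 ![((of, sP), 1), (((t₁, of.2 + Torus.proj Lf (Torus.cRep ybar)), sM), 1)]
  let G : (Fin 2 → SrcLabel Lf M n) → ℝ := fun X =>
    ‖kernel ℂ Af 2 X - (if ∀ i j, ((X i).1.1.2 j).val / L = ((X 0).1.1.2 j).val / L then
        kernel ℂ Ac 2 (fun i => ((((X i).1.1.1, fun j => ((((X i).1.1.2 j).val : ℕ) : ZMod L)), (X i).1.2), (X i).2)) else 0)‖
  let Xf : ImagTimeIdx M → TorusSite 2 L → (Fin 2 → SrcLabel Lf M n) := fun t₁ ybar =>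
    ![((of, sP), 1), (((t₁, of.2 + Torus.proj Lf (Torus.cRep ybar)), sM), 1)]
  let Pn : TorusSite 2 L → Prop := fun ybar => ∀ i, (Torus.cRepZ (ybar i)).natAbs < R
  haveI hPnDec : DecidablePred Pn := fun ybar => by dsimp only [Pn]; infer_instance
  show 2 * ε * (∑ t₁, ∑ ybar, ‖a t₁ ybar - f t₁ ybar‖) ≤
    2 * ε * (∑ X ∈ univ.filter (fun X : Fin 2 → SrcLabel Lf M n => X 0 = ((of, sP), 1)), G X) + 2 * (Bc + Bf) / (1 + Λ * R)
  -- (A) near offsets ARE glued strings at the pin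
  have hnear : ∀ (t₁ : ImagTimeIdx M) (ybar : TorusSite 2 L), Pn ybar → ‖a t₁ ybar - f t₁ ybar‖ = G (Xf t₁ ybar) := by
    intro t₁ ybar hy
    have hblk : ∀ i j, (((Xf t₁ ybar) i).1.1.2 j).val / L = (((Xf t₁ ybar) 0).1.1.2 j).val / L := by
      intro i j
      fin_cases i
      · rfl
      · exact block_eq_of_deep_of_natAbs_lt hLf of.2 hof ybar hy j
    have hres : (fun i => (((((Xf t₁ ybar) i).1.1.1, fun j => (((((Xf t₁ ybar) i).1.1.2 j).val : ℕ) : ZMod L)), ((Xf t₁ ybar) i).1.2),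
        ((Xf t₁ ybar) i).2) : Fin 2 → SrcLabel L M n) = ![(((of.1, ocs), sP), 1), (((t₁, ocs + ybar), sM), 1)] := by
      funext i
      fin_cases i
      · rfl
      · show ((((t₁, fun j => ((((of.2 + Torus.proj Lf (Torus.cRep ybar)) j).val : ℕ) : ZMod L)), sM), 1) : SrcLabel L M n) =
          (((t₁, ocs + ybar), sM), 1)
        rw [reduce_add_clift hLf]
    show ‖a t₁ ybar - f t₁ ybar‖ = ‖kernel ℂ Af 2 (Xf t₁ ybar) - _‖
    rw [if_pos hblk, hres, norm_sub_rev]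
  -- (B) the near part ≤ the glued pinned defect
  have hG0 : ∀ X, 0 ≤ G X := fun X => norm_nonneg _
  have hXinj : Function.Injective (fun q : ImagTimeIdx M × TorusSite 2 L => Xf q.1 q.2) := by
    have hX1 : ∀ q : ImagTimeIdx M × TorusSite 2 L, ((Xf q.1 q.2) 1).1.1 = (q.1, of.2 + Torus.proj Lf (Torus.cRep q.2)) := fun q => rfl
    intro q q' h
    have h1 : ((Xf q.1 q.2) 1).1.1 = ((Xf q'.1 q'.2) 1).1.1 := congrArg (fun X : Fin 2 → SrcLabel Lf M n => (X 1).1.1) h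
    rw [hX1 q, hX1 q'] at h1
    obtain ⟨ht, hs⟩ := Prod.mk.inj h1
    exact Prod.ext ht (clift_injective hLf (add_left_cancel hs))
  have hB : ∑ t₁, ∑ ybar ∈ univ.filter Pn, ‖a t₁ ybar - f t₁ ybar‖ ≤
      ∑ X ∈ univ.filter (fun X : Fin 2 → SrcLabel Lf M n => X 0 = ((of, sP), 1)), G X := by
    haveI hdecX : DecidableEq (Fin 2 → SrcLabel Lf M n) := Classical.decEq _
    calc ∑ t₁, ∑ ybar ∈ univ.filter Pn, ‖a t₁ ybar - f t₁ ybar‖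
        = ∑ t₁, ∑ ybar ∈ univ.filter Pn, G (Xf t₁ ybar) :=
          sum_congr rfl fun t₁ _ => sum_congr rfl fun ybar hy => hnear t₁ ybar (mem_filter.1 hy).2
      _ ≤ ∑ t₁, ∑ ybar, G (Xf t₁ ybar) :=
          sum_le_sum fun t₁ _ => sum_le_sum_of_subset_of_nonneg (filter_subset _ _) fun ybar _ _ => hG0 _
      _ = ∑ q : ImagTimeIdx M × TorusSite 2 L, G (Xf q.1 q.2) :=
          (Fintype.sum_prod_type fun q : ImagTimeIdx M × TorusSite 2 L => G (Xf q.1 q.2)).symm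
      _ = ∑ X ∈ (univ : Finset (ImagTimeIdx M × TorusSite 2 L)).image (fun q => Xf q.1 q.2), G X :=
          (sum_image fun q _ q' _ h => hXinj h).symm
      _ ≤ ∑ X ∈ univ.filter (fun X : Fin 2 → SrcLabel Lf M n => X 0 = ((of, sP), 1)), G X := by
          refine sum_le_sum_of_subset_of_nonneg ?_ fun X _ _ => hG0 X
          intro X hX
          obtain ⟨q, -, rfl⟩ := mem_image.1 hX
          exact mem_filter.2 ⟨mem_univ _, rfl⟩
  -- (C) the far part ≤ far rows of both volumes
  have hfar_y : ∀ ybar ∈ (univ : Finset (TorusSite 2 L)), ¬ Pn ybar → R ≤ Torus.tnorm ybar := fun ybar _ h => le_tnorm_of_not_near h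
  have hfar_y' : ∀ ybar ∈ (univ : Finset (TorusSite 2 L)), ¬ Pn ybar → R ≤ Torus.tnorm (Torus.proj Lf (Torus.cRep ybar)) :=
    fun ybar _ h => (le_tnorm_of_not_near h).trans (tnorm_le_tnorm_clift hLf ybar)
  have hC1 : ∀ t₁ : ImagTimeIdx M, ∑ ybar ∈ univ.filter (fun y => ¬ Pn y), ‖a t₁ ybar‖ ≤
      (1 + Λ * R)⁻¹ * ∑ ybar, (1 + Λ * (Torus.tnorm ybar : ℝ)) * ‖a t₁ ybar‖ := fun t₁ =>
    sum_filter_le_inv_mul_weighted univ Pn (fun y => ‖a t₁ y‖) (fun y => Torus.tnorm y) (fun _ _ => norm_nonneg _) hΛ hfar_y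
  have hC2 : ∀ t₁ : ImagTimeIdx M, ∑ ybar ∈ univ.filter (fun y => ¬ Pn y), ‖f t₁ ybar‖ ≤
      (1 + Λ * R)⁻¹ * ∑ y' : TorusSite 2 Lf, (1 + Λ * (Torus.tnorm y' : ℝ)) * ‖kernel ℂ Af 2 ![((of, sP), 1), (((t₁, of.2 + y'), sM), 1)]‖ := by
    intro t₁
    refine (sum_filter_le_inv_mul_weighted univ Pn (fun y => ‖f t₁ y‖) (fun y => Torus.tnorm (Torus.proj Lf (Torus.cRep y)))
      (fun _ _ => norm_nonneg _) hΛ hfar_y').trans ?_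
    refine mul_le_mul_of_nonneg_left ?_ (by positivity)
    -- reindex by the injective centred lift and drop the other fine offsets
    let g : TorusSite 2 Lf → ℝ := fun y' => (1 + Λ * (Torus.tnorm y' : ℝ)) * ‖kernel ℂ Af 2 ![((of, sP), 1), (((t₁, of.2 + y'), sM), 1)]‖
    have hg0 : ∀ y', 0 ≤ g y' := fun y' => by positivity
    calc ∑ y, (1 + Λ * (Torus.tnorm (Torus.proj Lf (Torus.cRep y)) : ℝ)) * ‖f t₁ y‖
        = ∑ y, g (Torus.proj Lf (Torus.cRep y)) := rfl
      _ = ∑ y' ∈ (univ : Finset (TorusSite 2 L)).image (fun y => Torus.proj Lf (Torus.cRep y)), g y' :=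
          (sum_image fun y _ y' _ h => clift_injective hLf h).symm
      _ ≤ ∑ y', g y' := sum_le_sum_of_subset_of_nonneg (subset_univ _) fun y' _ _ => hg0 y'
  -- the weighted rows are token #24's two-source pinned sums
  have hWc : ε * ∑ t₁, ∑ ybar, (1 + Λ * (Torus.tnorm ybar : ℝ)) * ‖a t₁ ybar‖ ≤ Bc := by
    have h := weightedRows_le_klSrcPinnedSum (L := L) (M := M) hβ U μ Kc n (of.1, ocs)
    refine le_trans (le_of_eq ?_) (h.trans hBc)
    simp only [hε_def, hΛ_def, a, hAc, hsP, hsM, kernel_srcTrunc_klSrcAction_pair]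
  have hWf : ε * ∑ t₁, ∑ y' : TorusSite 2 Lf, (1 + Λ * (Torus.tnorm y' : ℝ)) * ‖kernel ℂ Af 2 ![((of, sP), 1), (((t₁, of.2 + y'), sM), 1)]‖ ≤ Bf := by
    have h := weightedRows_le_klSrcPinnedSum (L := Lf) (M := M) hβ U μ Kf n of
    refine le_trans (le_of_eq ?_) (h.trans hBf)
    simp only [hε_def, hΛ_def, hAf, hsP, hsM, kernel_srcTrunc_klSrcAction_pair]
  -- assemble
  have hsplit : ∀ t₁ : ImagTimeIdx M, ∑ ybar, ‖a t₁ ybar - f t₁ ybar‖ =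
      (∑ ybar ∈ univ.filter Pn, ‖a t₁ ybar - f t₁ ybar‖) + ∑ ybar ∈ univ.filter (fun y => ¬ Pn y), ‖a t₁ ybar - f t₁ ybar‖ :=
    fun t₁ => (sum_filter_add_sum_filter_not _ _ _).symm
  have hfar : ∀ t₁ : ImagTimeIdx M, ∑ ybar ∈ univ.filter (fun y => ¬ Pn y), ‖a t₁ ybar - f t₁ ybar‖ ≤
      (1 + Λ * R)⁻¹ * ∑ ybar, (1 + Λ * (Torus.tnorm ybar : ℝ)) * ‖a t₁ ybar‖ +
        (1 + Λ * R)⁻¹ * ∑ y' : TorusSite 2 Lf, (1 + Λ * (Torus.tnorm y' : ℝ)) * ‖kernel ℂ Af 2 ![((of, sP), 1), (((t₁, of.2 + y'), sM), 1)]‖ := by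
    intro t₁
    refine le_trans (sum_le_sum fun ybar _ => norm_sub_le (a t₁ ybar) (f t₁ ybar)) ?_
    rw [sum_add_distrib]
    exact add_le_add (hC1 t₁) (hC2 t₁)
  have hR1 : (0 : ℝ) < 1 + Λ * R := by positivity
  calc 2 * ε * ∑ t₁, ∑ ybar, ‖a t₁ ybar - f t₁ ybar‖
      = 2 * ε * ∑ t₁, ((∑ ybar ∈ univ.filter Pn, ‖a t₁ ybar - f t₁ ybar‖) +
          ∑ ybar ∈ univ.filter (fun y => ¬ Pn y), ‖a t₁ ybar - f t₁ ybar‖) := by simp_rw [← hsplit]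
    _ = 2 * ε * (∑ t₁, ∑ ybar ∈ univ.filter Pn, ‖a t₁ ybar - f t₁ ybar‖) +
          2 * ε * ∑ t₁, ∑ ybar ∈ univ.filter (fun y => ¬ Pn y), ‖a t₁ ybar - f t₁ ybar‖ := by rw [sum_add_distrib, mul_add]
    _ ≤ 2 * ε * (∑ X ∈ univ.filter (fun X : Fin 2 → SrcLabel Lf M n => X 0 = ((of, sP), 1)), G X) +
          2 * ε * ∑ t₁, ((1 + Λ * R)⁻¹ * ∑ ybar, (1 + Λ * (Torus.tnorm ybar : ℝ)) * ‖a t₁ ybar‖ +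
            (1 + Λ * R)⁻¹ * ∑ y' : TorusSite 2 Lf, (1 + Λ * (Torus.tnorm y' : ℝ)) *
              ‖kernel ℂ Af 2 ![((of, sP), 1), (((t₁, of.2 + y'), sM), 1)]‖) := by
        have h2ε : 0 ≤ 2 * ε := by positivity
        exact add_le_add (mul_le_mul_of_nonneg_left hB h2ε) (mul_le_mul_of_nonneg_left (sum_le_sum fun t₁ _ => hfar t₁) h2ε)
    _ = 2 * ε * (∑ X ∈ univ.filter (fun X : Fin 2 → SrcLabel Lf M n => X 0 = ((of, sP), 1)), G X) +
          2 * (1 + Λ * R)⁻¹ * (ε * ∑ t₁, ∑ ybar, (1 + Λ * (Torus.tnorm ybar : ℝ)) * ‖a t₁ ybar‖ +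
            ε * ∑ t₁, ∑ y' : TorusSite 2 Lf, (1 + Λ * (Torus.tnorm y' : ℝ)) *
              ‖kernel ℂ Af 2 ![((of, sP), 1), (((t₁, of.2 + y'), sM), 1)]‖) := by
        rw [sum_add_distrib, ← mul_sum, ← mul_sum]; ring
    _ ≤ 2 * ε * (∑ X ∈ univ.filter (fun X : Fin 2 → SrcLabel Lf M n => X 0 = ((of, sP), 1)), G X) +
          2 * (1 + Λ * R)⁻¹ * (Bc + Bf) := by
        have h2R : 0 ≤ 2 * (1 + Λ * R)⁻¹ := by positivity
        exact add_le_add le_rfl (mul_le_mul_of_nonneg_left (add_le_add hWc hWf) h2R)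
    _ = _ := by rw [div_eq_mul_inv]; ring

end NearGlued

end Summit.HubbardSuperconductivity.HubbardSuperconductivity.Theorems.TwoVolumeSource

end
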